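import Literature.AlgebraicGeometry.Frobenioids.Endomorphisms
import HarnessLib

/-!
# Frobenioids I, Proposition 1.12 (ii)–(iv) under the elementwise hypothesis (H)

Mochizuki, *The geometry of Frobenioids I: the general theory*, Kyushu J. Math. **62** (2008)
293–400, §1, Proposition 1.12, kurims text p. 39 [cite: MochizukiFrdI2008, Prop. 1.12(ii) p.39].

PROOF-AND-HYPOTHESIS companion of `Endomorphisms.lean` (seat abc-iut-L1-t1; statements untouched,
never restated). That file proves Prop. 1.12 (i), the cheap directions of (ii)/(iii), keeps the
printed (ii)⇒"isometric", (iii)⇐ and (iv) as `Prop`-valued statements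
(`SubAutomorphismIsIsometryStatement`, `EndoIsSubAutomorphismIffStatement`,
`SubAutomorphismIsIsoIffStatement`, `AutSaturatedIffStatement`) — they fail as printed, see the
kernel-checked `EndomorphismsCounterexample.lean` — and proves them under `AutFixesDiv F`
("automorphisms act trivially on zero divisors": `Base(β)^* Div(φ) = Div(φ)`).

`AutFixesDiv` is exactly the equality the printed argument uses, but it EXCLUDES the motivating
arithmetic Frobenioids ([FrdI] Ex. 6.3: over a Galois base category a nontrivial automorphism `σ`
of a number field `L` moves some prime — kernel-checked in this tree as
`Literature.NumberTheory.NumberFields.exists_map_heightOneSpectrum_ne`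
(`AutomorphismMovesPrime.lean`) — so `σ^* Div(φ) ≠ Div(φ)` for a suitable arithmetic divisor).
This file (OURS — a repair, not attributed to the paper; L1-lead ruling P12-NE) records the weaker
ELEMENTWISE hypothesis

  (H) `IsAutNonExpandingOn Φ`: for every `A ∈ Ob(D)`, `b ∈ Aut_D(A)`, `x ∈ Φ(A)`:
      `x ≤ b^* x ⇒ b^* x = x`

(automorphisms of the base never STRICTLY enlarge a divisor), proves that (H) also makes the
printed Remark-1.1.1 argument go through — hence Prop. 1.12 (ii), (iii), (iv) exactly as typed by
`Endomorphisms.lean` hold under (H) — and proves that (H) is AUTOMATIC whenever every base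
automorphism acts on `Φ(A)` with finite order (`isAutNonExpandingOn_of_finite_order`; e.g. the
connected objects of a Galois category, where `Aut_D(A)` is finite). Both kernel-checked
counterexamples (abc-iut-L1-t1's `ℚ_{≥0}`/`×2`; the non-dilating `ℕ^ℤ`/shift of the RQ7 audit)
violate (H), and Mochizuki's own "non-dilating" condition (Def. 1.1 (i)) does NOT imply (H).
No statement of the paper is strengthened or weakened; nothing disputed is asserted.
-/

namespace Literature.AlgebraicGeometry.Frobenioids

open CategoryTheory Opposite

universe w v v' u u'

variable {D : Type u} [Category.{v} D]

/-- Hypothesis **(H)** (OURS): *automorphisms of the base never strictly enlarge a divisor* —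
for `b ∈ Aut_D(A)` and `x ∈ Φ(A)`, `x ∣ b^* x ⇒ b^* x = x` (multiplicative notation: the order `≤`
of the divisor monoid is divisibility `∣`). This is what the printed proof of Prop. 1.12 (ii)
("immediate from Remark 1.1.1") needs of the equality `Base(β)^* Div(φ) = Base(φ)^* Div(α) + Div(φ)`.
[cite: MochizukiFrdI2008, Prop. 1.12(ii) p.39] -/
def IsAutNonExpandingOn (Φ : Dᵒᵖ ⥤ CommMonCat.{w}) : Prop :=
  ∀ ⦃A : D⦄ (b : A ≅ A) (x : Φ.obj (op A)), x ∣ pull Φ b.hom x → pull Φ b.hom x = x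

/-- (H) is automatic when every base automorphism acts on divisors with finite order: if
`(b^*)^k = id` for some `k ≥ 1` then from `x ∣ b^* x` one gets `b^* x ∣ (b^*)^k x = x`, and `∣` is
antisymmetric in a sharp cancellative (divisorial) monoid. Covers every base category whose
automorphism groups are torsion, e.g. the connected objects of a Galois category.
[cite: MochizukiFrdI2008, Prop. 1.12(ii) p.39] -/
theorem isAutNonExpandingOn_of_finite_order {Φ : Dᵒᵖ ⥤ CommMonCat.{w}}
    (hdiv : ∀ A : D, IsDivisorial (Φ.obj (op A)))
    (hfin : ∀ ⦃A : D⦄ (b : A ≅ A), ∃ k : ℕ, 0 < k ∧ ∀ x : Φ.obj (op A), (pull Φ b.hom)^[k] x = x) :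
    IsAutNonExpandingOn Φ := by
  intro A b x hx
  obtain ⟨k, hk, hper⟩ := hfin b
  have step : ∀ i : ℕ, (pull Φ b.hom)^[i] x ∣ (pull Φ b.hom)^[i + 1] x := by
    intro i
    induction i with
    | zero => simpa using hx
    | succ i ih =>
      rw [Function.iterate_succ_apply', Function.iterate_succ_apply']
      exact map_dvd (pull Φ b.hom) ih
  have chain : ∀ i : ℕ, 1 ≤ i → pull Φ b.hom x ∣ (pull Φ b.hom)^[i] x := by
    intro i hi
    induction i with
    | zero => omega
    | succ i ih =>
      rcases Nat.eq_zero_or_pos i with h0 | hpos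
      · subst h0; simp
      · exact (ih hpos).trans (step i)
  have hback : pull Φ b.hom x ∣ x := by
    have := chain k hk
    rwa [hper x] at this
  haveI : IsCancelMul (Φ.obj (op A)) :=
    isIntegral_iff_isCancelMul.mp (hdiv A).isPreDivisorial.isIntegral
  exact dvd_antisymm_of_isSharp (hdiv A).isSharp hback hx

namespace PreFrobenioid

variable {Φ : Dᵒᵖ ⥤ CommMonCat.{w}} {C : Type u'} [Category.{v'} C] {F : C ⥤ ElemFrobenioid Φ}

/-- Over a pre-Frobenioid `C → F_Φ` the divisor monoid is divisorial, so (H) follows from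
finite-order action alone. [cite: MochizukiFrdI2008, Prop. 1.12(ii) p.39] -/
theorem isAutNonExpandingOn_of_isPreFrobenioid_of_finite_order (hP : IsPreFrobenioid Φ F)
    (hfin : ∀ ⦃A : D⦄ (b : A ≅ A), ∃ k : ℕ, 0 < k ∧ ∀ x : Φ.obj (op A), (pull Φ b.hom)^[k] x = x) :
    IsAutNonExpandingOn Φ :=
  isAutNonExpandingOn_of_finite_order (fun A => hP.isDivisorial A) hfin

/-- **Prop. 1.12 (ii), printed necessity, under (H)**: in a pre-Frobenioid whose divisor monoid
satisfies (H), every sub-automorphism is isometric. The proof is the printed one: apply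
Remark 1.1.1 to `φ ∘ β = α ∘ φ` to get `Base(β)^* Div(φ) = Base(φ)^* Div(α) · Div(φ)`; (H) gives
`Base(β)^* Div(φ) = Div(φ)`; cancel (`Φ` integral) and use that `Base(φ)^*` is characteristically
injective. [cite: MochizukiFrdI2008, Prop. 1.12(ii) p.39] -/
theorem IsSubAutomorphism.isIsometry_of_isAutNonExpandingOn (hP : IsPreFrobenioid Φ F)
    (hH : IsAutNonExpandingOn Φ) {A : C} {α : A ⟶ A} (h : IsSubAutomorphism α) :
    IsIsometry F α := by
  have hlin : IsLinear F α := IsSubAutomorphism.isLinear h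
  obtain ⟨B, φ, β, hsq⟩ := h
  have hd := congrArg (Div F) hsq
  rw [div_comp, div_comp, isIsometry_of_isIso F hP β.hom, one_pow, mul_one,
    show degFr F α = 1 from hlin, PNat.one_coe, pow_one] at hd
  -- hd : `Base(β)^* Div φ = Base(φ)^* Div α · Div φ`
  have hdvd : Div F φ ∣ pull Φ (Base F β.hom) (Div F φ) :=
    ⟨pull Φ (Base F φ) (Div F α), by rw [hd, mul_comm]⟩
  have hfix : pull Φ (Base F β.hom) (Div F φ) = Div F φ :=
    hH ((baseFunctor F).mapIso β) (Div F φ) hdvd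
  haveI : IsCancelMul (Φ.obj (op (baseObj F B))) :=
    isIntegral_iff_isCancelMul.mp (hP.isDivisorial _).isPreDivisorial.isIntegral
  have h1 : 1 * Div F φ = pull Φ (Base F φ) (Div F α) * Div F φ := by
    rw [one_mul]
    exact hfix.symm.trans hd
  have h2 : pull Φ (Base F φ) (Div F α) = 1 := (mul_right_cancel h1).symm
  exact (hP.isMonoidOn.isCharInjective (Base F φ)).1 (by rw [h2, map_one])

/-- Under (H): the printed necessity of Prop. 1.12 (ii), as the statement typed in
`Endomorphisms.lean`. [cite: MochizukiFrdI2008, Prop. 1.12(ii) p.39] -/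
theorem subAutomorphismIsIsometryStatement_of_isAutNonExpandingOn (hP : IsPreFrobenioid Φ F)
    (hH : IsAutNonExpandingOn Φ) (A : C) : SubAutomorphismIsIsometryStatement F A :=
  fun _ h => IsSubAutomorphism.isIsometry_of_isAutNonExpandingOn hP hH h

/-- Under (H): Prop. 1.12 (ii) as printed ("an endomorphism of `A` is a sub-automorphism if and
only if it is an isometric linear endomorphism that projects to a sub-automorphism of `D`").
[cite: MochizukiFrdI2008, Prop. 1.12(ii) p.39] -/
theorem endoIsSubAutomorphismIffStatement_of_isAutNonExpandingOn (hF : IsFrobenioid F)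
    (hH : IsAutNonExpandingOn Φ) (A : C) : EndoIsSubAutomorphismIffStatement F A := fun _ =>
  ⟨fun h => ⟨IsSubAutomorphism.isIsometry_of_isAutNonExpandingOn hF.isPreFrobenioid hH h,
      IsSubAutomorphism.isLinear h, IsSubAutomorphism.base h⟩,
    fun h => isSubAutomorphism_of_isIsometry_isLinear hF h.1 h.2.1 h.2.2⟩

/-- Under (H): Prop. 1.12 (iii) as printed ("a sub-automorphism of `A` is an automorphism if and
only if it is a base-isomorphism") — an isometric, linear, base-isomorphic endomorphism is an
LB-invertible pre-step (endomorphisms are co-angular), hence an isomorphism by Prop. 1.4 (iii).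
[cite: MochizukiFrdI2008, Prop. 1.12(iii) p.39] -/
theorem subAutomorphismIsIsoIffStatement_of_isAutNonExpandingOn (hF : IsFrobenioid F)
    (hH : IsAutNonExpandingOn Φ) (A : C) : SubAutomorphismIsIsoIffStatement F A := fun α h =>
  ⟨fun _ => isBaseIso_of_isIso F α, fun hb =>
    isIso_of_isLBInvertible_of_isPreStep F hF α
      ⟨isCoAngular_endo F hF α,
        IsSubAutomorphism.isIsometry_of_isAutNonExpandingOn hF.isPreFrobenioid hH h⟩
      ⟨IsSubAutomorphism.isLinear h, hb⟩⟩

/-- Under (H): Prop. 1.12 (iv) as printed ("Suppose that `A` is `Aut^sub`-ample. Then `A` is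
`Aut`-saturated if and only if `A_D` is") — "follows formally from assertions (ii), (iii)".
[cite: MochizukiFrdI2008, Prop. 1.12(iv) p.39] -/
theorem autSaturatedIffStatement_of_isAutNonExpandingOn (hF : IsFrobenioid F)
    (hH : IsAutNonExpandingOn Φ) (A : C) : AutSaturatedIffStatement F A := fun hamp =>
  ⟨isAutSaturatedObj_base A hamp,
    isAutSaturatedObj_of_base A (subAutomorphismIsIsoIffStatement_of_isAutNonExpandingOn hF hH A)⟩

end PreFrobenioid

end Literature.AlgebraicGeometry.Frobenioids
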